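import Mathlib
import Literature.NumberTheory.Sieve.Maynard2016IntervalPrimes
import HarnessLib

/-!
# Maynard 2016: `ω_{m,q}(p)` at the primes `p ≤ w` (classes modulo `P_w`)

Topic `Literature/NumberTheory/Sieve`. J. Maynard, *Large gaps between primes*, Ann. of Math. (2)
183 (2016), 915–933 = arXiv:1408.5110, §5 display (5.1) and §6 (proof of Lemma 6, display (6.6);
proof of Lemma 7: "we first split the sum into residue classes modulo `P_w`"). Since every
`h ∈ 𝓗` is a multiple of `P_w = ∏_{p ≤ w} p`, for a prime `p ∣ P_w` the conditions defining
`ω_{m,q}(p)` do not see the shifts `h_i q`: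
`ω_{m,q}(p) = #{1 ≤ n ≤ p : n ≡ 0 or mn ≡ 1 (mod p)} = 1` if `p ∣ m` and `= 2` if `p ∤ m`.

PROVED here (no named facts; independent of `Maynard2016OmegaBound`): `omegaMQ_eq_card_of_dvd_Pw`, `card_filter_dvd_or_mul_modEq_one`,
`omegaMQ_eq_of_dvd_Pw` (for `k ≥ 1`: `ω_{m,q}(p) = if p ∣ m then 1 else 2`) and
`omegaMQ_two` (`m` even: `ω_{m,q}(2) = 1`).

## References

* J. Maynard, *Large gaps between primes*, Ann. of Math. (2) 183 (2016), 915–933; arXiv:1408.5110,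
  §5 (5.1), §6 (6.6) and Lemma 7 (proof). [Maynard2016LargeGaps]
-/

open Filter Finset
open scoped Topology

namespace Literature.NumberTheory.Sieve

namespace Maynard2016

/-- Two integers of `[1, p]` that are congruent modulo `p` are equal. [folklore] -/
private theorem eq_of_modEq_of_mem_Icc' {p a b : ℕ} (ha : a ∈ Finset.Icc 1 p)
    (hb : b ∈ Finset.Icc 1 p) (h : a ≡ b [MOD p]) : a = b := by
  simp only [Finset.mem_Icc] at ha hb
  rcases le_total a b with hab | hab
  · have h1 := (Nat.modEq_iff_dvd' hab).1 h
    have h2 : b - a = 0 := Nat.eq_zero_of_dvd_of_lt h1 (by omega)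
    omega
  · have h1 := (Nat.modEq_iff_dvd' hab).1 h.symm
    have h2 : a - b = 0 := Nat.eq_zero_of_dvd_of_lt h1 (by omega)
    omega

/-- For `k ≥ 1` and a prime `p ∣ P_w` the set defining `ω_{m,q}(p)` is
`{1 ≤ n ≤ p : p ∣ n ∨ mn ≡ 1 (mod p)}` (the shifts `h_i q` are `≡ 0 (mod p)`). [cite: Maynard2016LargeGaps, §6 display (6.6)] -/
theorem omegaMQ_eq_card_of_dvd_Pw {k : ℕ} (hk : 0 < k) (x m q : ℕ) {p : ℕ} (hpw : p ∣ Pw x) :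
    omegaMQ k x m q p =
      ((Finset.Icc 1 p).filter (fun n => p ∣ n ∨ m * n ≡ 1 [MOD p])).card := by
  classical
  unfold omegaMQ
  refine congrArg Finset.card (Finset.filter_congr fun n _ => ?_)
  have hAB : ∀ i : Fin k, (p ∣ n + hTuple k x i * q ↔ p ∣ n) ∧
      (m * (n + hTuple k x i * q) ≡ 1 [MOD p] ↔ m * n ≡ 1 [MOD p]) := by
    intro i
    have hc : p ∣ hTuple k x i * q := (hpw.trans (Pw_dvd_hTuple k x i)).mul_right q
    refine ⟨⟨fun h => (Nat.dvd_add_right hc).1 (by rwa [add_comm] at h), fun h => dvd_add h hc⟩, ?_⟩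
    have hmod : m * (n + hTuple k x i * q) ≡ m * n [MOD p] := by
      obtain ⟨t, ht⟩ := hc
      rw [ht, show m * (n + p * t) = m * n + p * (m * t) by ring]
      exact Nat.add_mul_mod_self_left _ _ _
    exact ⟨fun h => hmod.symm.trans h, fun h => hmod.trans h⟩
  constructor
  · rintro ⟨i, h | h⟩
    · exact Or.inl ((hAB i).1.1 h)
    · exact Or.inr ((hAB i).2.1 h)
  · rintro (h | h)
    · exact ⟨⟨0, hk⟩, Or.inl ((hAB _).1.2 h)⟩
    · exact ⟨⟨0, hk⟩, Or.inr ((hAB _).2.2 h)⟩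

/-- `#{1 ≤ n ≤ p : p ∣ n ∨ mn ≡ 1 (mod p)} = 1` if `p ∣ m` and `= 2` otherwise (`p` prime). [cite: Maynard2016LargeGaps, §6 display (6.6)] -/
theorem card_filter_dvd_or_mul_modEq_one {p : ℕ} (hp : p.Prime) (m : ℕ) :
    ((Finset.Icc 1 p).filter (fun n => p ∣ n ∨ m * n ≡ 1 [MOD p])).card =
      if p ∣ m then 1 else 2 := by
  classical
  -- `mn ≡ 1 (mod p)` is incompatible with `p ∣ mn`
  have hne1 : ∀ n, p ∣ m * n → ¬ m * n ≡ 1 [MOD p] := by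
    intro n hd h
    have h0 : m * n ≡ 0 [MOD p] := Nat.modEq_zero_iff_dvd.2 hd
    have : p ∣ 1 := Nat.modEq_zero_iff_dvd.1 (h.symm.trans h0)
    exact hp.one_lt.ne' (Nat.dvd_one.1 this)
  have hsplit : (Finset.Icc 1 p).filter (fun n => p ∣ n ∨ m * n ≡ 1 [MOD p]) =
      (Finset.Icc 1 p).filter (fun n => p ∣ n) ∪
        (Finset.Icc 1 p).filter (fun n => m * n ≡ 1 [MOD p]) := by
    ext n
    simp only [Finset.mem_filter, Finset.mem_union]
    tauto
  have hdisj : Disjoint ((Finset.Icc 1 p).filter (fun n => p ∣ n))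
      ((Finset.Icc 1 p).filter (fun n => m * n ≡ 1 [MOD p])) :=
    Finset.disjoint_filter.2 fun n _ hn => hne1 n (hn.mul_left m)
  have hA : (Finset.Icc 1 p).filter (fun n => p ∣ n) = {p} := by
    ext n
    simp only [Finset.mem_filter, Finset.mem_Icc, Finset.mem_singleton]
    constructor
    · rintro ⟨⟨h1, h2⟩, h⟩
      exact le_antisymm h2 (Nat.le_of_dvd (by omega) h)
    · rintro rfl
      exact ⟨⟨hp.one_lt.le, le_rfl⟩, dvd_rfl⟩
  rw [hsplit, Finset.card_union_of_disjoint hdisj, hA, Finset.card_singleton]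
  split_ifs with hpm
  · have hB : (Finset.Icc 1 p).filter (fun n => m * n ≡ 1 [MOD p]) = ∅ :=
      Finset.filter_eq_empty_iff.2 fun n _ h => hne1 n (hpm.mul_right n) h
    rw [hB, Finset.card_empty]
  · have hcop' : Nat.gcd p m = 1 := (Nat.Prime.coprime_iff_not_dvd hp).2 hpm
    have hle : ((Finset.Icc 1 p).filter (fun n => m * n ≡ 1 [MOD p])).card ≤ 1 := by
      refine Finset.card_le_one.2 fun a ha b hb => ?_
      rw [Finset.mem_filter] at ha hb
      exact eq_of_modEq_of_mem_Icc' ha.1 hb.1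
        (Nat.ModEq.cancel_left_of_coprime hcop' (ha.2.trans hb.2.symm))
    have hne : ((Finset.Icc 1 p).filter (fun n => m * n ≡ 1 [MOD p])).Nonempty := by
      have hcop : Nat.Coprime m p := ((Nat.Prime.coprime_iff_not_dvd hp).2 hpm).symm
      obtain ⟨w, hwp, hw⟩ := Nat.exists_mul_mod_eq_one_of_coprime hcop hp.one_lt
      have hw0 : w ≠ 0 := by
        rintro rfl
        simp at hw
      refine ⟨w, Finset.mem_filter.2 ⟨Finset.mem_Icc.2 ⟨Nat.one_le_iff_ne_zero.2 hw0, hwp.le⟩, ?_⟩⟩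
      show m * w % p = 1 % p
      rw [hw, Nat.mod_eq_of_lt hp.one_lt]
    have := Finset.card_pos.2 hne
    omega

/-- **`ω_{m,q}(p)` for `p ∣ P_w` (`k ≥ 1`):** `ω_{m,q}(p) = 1` if `p ∣ m` and `= 2` if `p ∤ m`. [cite: Maynard2016LargeGaps, §6 display (6.6) and Lemma 7 (proof, «classes modulo P_w»)] -/
theorem omegaMQ_eq_of_dvd_Pw {k : ℕ} (hk : 0 < k) (x m q : ℕ) {p : ℕ} (hp : p.Prime)
    (hpw : p ∣ Pw x) : omegaMQ k x m q p = if p ∣ m then 1 else 2 := by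
  rw [omegaMQ_eq_card_of_dvd_Pw hk x m q hpw, card_filter_dvd_or_mul_modEq_one hp m]

/-- For even `m`, `k ≥ 1` and `2 ∣ P_w` (i.e. `w ≥ 2`): `ω_{m,q}(2) = 1`, so the factor of `𝔖_{m,q}`
at `p = 2` is `(1 − 1/2)(1 − 1/2)^{−2k} > 0`. [cite: Maynard2016LargeGaps, §5 display (5.2)] -/
theorem omegaMQ_two {k : ℕ} (hk : 0 < k) (x q : ℕ) {m : ℕ} (hm : Even m) (h2 : 2 ∣ Pw x) :
    omegaMQ k x m q 2 = 1 := by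
  rw [omegaMQ_eq_of_dvd_Pw hk x m q Nat.prime_two h2, if_pos (even_iff_two_dvd.1 hm)]

end Maynard2016

end Literature.NumberTheory.Sieve
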